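import Mathlib
import Summits.CriticalPhenomena.Ising3DConformalLimit.Theorems.LatticeSDPCertificatesCertifiedWindowHeatBathRows
import Summits.CriticalPhenomena.Ising3DConformalLimit.Theorems.LatticeSDPCertificatesCertifiedWindowMomentPositivity
import HarnessLib

/-!
# Route `LatticeSDPCertificates`, crux `CertifiedWindow` (stmt-CriticalPhenomena-5504):
# heat-bath rows in pattern form imply single-site detailed balance

Abstract setting: a finite volume `Λ`, a functional `E : Finset V → ℝ` and a weight
`ρ : (Λ → ℤˣ) → ℝ` whose `+`-glued moments are `E`, i.e. `Σ_τ ρ(τ) σ^τ_B = E(B)` for all `B ⊆ Λ`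
(`σ^τ := glue Λ τ plus`). If `E` satisfies, at a site `x ∈ Λ` whose neighbourhood `N(x)` lies in
`Λ`, the "pattern form" of the one-site heat-bath (spin-flip / Schwinger–Dyson) rows

`Σ_{S ⊆ N(x)} π_S E({x} ∪ (B ∆ S)) = tanh(β Σ_{y ∈ N(x)} π_y) · Σ_{S ⊆ N(x)} π_S E(B ∆ S)`

for every pattern `π` and every `B ⊆ Λ` avoiding `x`, then `ρ` satisfies single-site detailed
balance at `x`: `ρ(τ) e^{-β σ_x Σ_{y∼x} σ_y} = ρ(τ^x) e^{+β σ_x Σ_{y∼x} σ_y}` (`τ^x` = `τ` flipped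
at `x`). Proof: test the rows against the Walsh kernel `Π_{y ∈ Λ∖x}(1 + π_y σ_y)` of the pattern
`π = σ^{τ}` (sum the row for `B` against `π_B` over `B ⊆ Λ ∖ ({x} ∪ N(x))`); the kernel localises
the moment sums onto the two configurations `τ, τ^x`, leaving
`σ_x (ρ(τ) - ρ(τ^x)) = tanh(β Σ_{y∼x} σ_y) (ρ(τ) + ρ(τ^x))`, which is the `tanh` form of detailed
balance (Friedli–Velenik 2017, Lemma 6.7). Helper file; theorems only.
-/

noncomputable section

namespace Summit.CriticalPhenomena.Ising3DConformalLimit.Theorems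

open Literature.Probability.LatticeModels Finset
open scoped symmDiff

/-! ### Elementary real algebra: the `tanh` form of detailed balance -/

/-- If `a - b = tanh(u) (a + b)` then `a e^{-u} = b e^{u}`. [folklore] -/
theorem mul_exp_neg_eq_mul_exp_of_tanh {a b u : ℝ} (h : a - b = Real.tanh u * (a + b)) :
    a * Real.exp (-u) = b * Real.exp u := by
  have key := tanh_mul_exp_add_exp_neg u
  linear_combination (Real.exp u + Real.exp (-u)) / 2 * h + (a + b) / 2 * key

/-- Signed version: for a sign `s = ±1`, `s (a - b) = tanh(β S) (a + b)` gives
`a e^{-β s S} = b e^{β s S}`. [folklore] -/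
theorem mul_exp_eq_mul_exp_of_sign_mul_tanh {s a b β S : ℝ} (hs : s = 1 ∨ s = -1)
    (h : s * (a - b) = Real.tanh (β * S) * (a + b)) :
    a * Real.exp (-(β * s * S)) = b * Real.exp (β * s * S) := by
  rcases hs with rfl | rfl
  · rw [mul_one]
    rw [one_mul] at h
    exact mul_exp_neg_eq_mul_exp_of_tanh h
  · rw [mul_neg_one, neg_mul, neg_neg]
    have h' : b - a = Real.tanh (β * S) * (b + a) := by linear_combination h
    exact (mul_exp_neg_eq_mul_exp_of_tanh h').symm

/-! ### Spin algebra -/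

section SpinAlgebra

variable {V : Type*}

/-- The Walsh kernel `Π_{y ∈ A} (1 + σ⁰_y σ_y)` at `σ = σ⁰` equals `2^{#A}` (`σ_y² = 1`).
[folklore] -/
theorem prod_one_add_spinAt_mul_self (A : Finset V) (σ : SpinConfig V) :
    ∏ y ∈ A, (1 + spinAt y σ * spinAt y σ) = 2 ^ A.card := by
  rw [← Finset.prod_const]
  exact Finset.prod_congr rfl fun y _ => by rw [spinAt_mul_self]; norm_num

/-- Two distinct spins `u ≠ v` in `ℤˣ` are opposite, so `1 + u v = 0` in `ℝ`. [folklore] -/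
theorem one_add_cast_mul_cast_eq_zero {u v : ℤˣ} (h : u ≠ v) :
    (1 : ℝ) + ((u : ℤ) : ℝ) * ((v : ℤ) : ℝ) = 0 := by
  rcases Int.units_eq_one_or u with rfl | rfl <;> rcases Int.units_eq_one_or v with rfl | rfl
  · exact absurd rfl h
  · norm_num
  · norm_num
  · exact absurd rfl h

variable [DecidableEq V]

/-- `σ_{insert x (B ∆ S)} = σ_x σ_B σ_S` when `x ∉ B`, `x ∉ S`. [folklore] -/
theorem spinProduct_insert_symmDiff {B S : Finset V} {x : V} (hxB : x ∉ B) (hxS : x ∉ S)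
    (σ : SpinConfig V) :
    spinProduct (insert x (B ∆ S)) σ = spinAt x σ * (spinProduct B σ * spinProduct S σ) := by
  have hx : x ∉ B ∆ S := fun h => by
    rcases Finset.mem_symmDiff.1 h with ⟨h1, _⟩ | ⟨h1, _⟩
    exacts [hxB h1, hxS h1]
  rw [spinProduct_mul_spinProduct, spinAt_mul_spinProduct_of_notMem hx]

/-- Gluing commutes with a one-site update inside `Λ`. [folklore] -/
theorem glue_update (Λ : Finset V) (τ : ↥Λ → ℤˣ) (bc : BoundaryCondition V) (i : ↥Λ)
    (u : ℤˣ) :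
    glue Λ (Function.update τ i u) bc = Function.update (glue Λ τ bc) (i : V) u := by
  funext y
  by_cases hyi : y = (i : V)
  · subst hyi
    rw [Function.update_self, glue_apply_of_mem _ _ _ i.2]
    simp
  · rw [Function.update_of_ne hyi]
    by_cases hy : y ∈ Λ
    · rw [glue_apply_of_mem _ _ _ hy, glue_apply_of_mem _ _ _ hy, Function.update_of_ne]
      exact fun h => hyi (congrArg Subtype.val h)
    · rw [glue_apply_of_notMem _ _ _ hy, glue_apply_of_notMem _ _ _ hy]

/-- A one-site update at `x` does not change the spin at `y ≠ x`. [folklore] -/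
theorem spinAt_update_of_ne {x y : V} (hyx : y ≠ x) (σ : SpinConfig V) (u : ℤˣ) :
    spinAt y (Function.update σ x u) = spinAt y σ := by
  simp [spinAt, Function.update_of_ne hyx]

/-- Flipping the spin at `x` negates `σ_x`. [folklore] -/
theorem spinAt_update_neg_self (x : V) (σ : SpinConfig V) :
    spinAt x (Function.update σ x (-σ x)) = -spinAt x σ := by
  simp [spinAt]

/-- The Walsh kernel over a set avoiding `x` does not see a spin update at `x`. [folklore] -/
theorem prod_one_add_spinAt_mul_update {A : Finset V} {x : V} (hx : x ∉ A) (π σ : SpinConfig V)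
    (u : ℤˣ) :
    ∏ y ∈ A, (1 + spinAt y π * spinAt y (Function.update σ x u)) =
      ∏ y ∈ A, (1 + spinAt y π * spinAt y σ) :=
  Finset.prod_congr rfl fun y hy => by
    rw [spinAt_update_of_ne (ne_of_mem_of_not_mem hy hx) σ u]

/-- **Localisation by the Walsh kernel.** For `x ∈ Λ` and a reference configuration `τ₀`,
the kernel `Π_{y ∈ Λ ∖ x}(1 + σ^{τ₀}_y σ^{τ}_y)` vanishes unless `τ` agrees with `τ₀` off `x`,
i.e. unless `τ ∈ {τ₀, τ₀^x}`, where it equals `2^{#(Λ ∖ x)}`; hence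
`Σ_τ f(τ) Π_{y ∈ Λ ∖ x}(1 + σ^{τ₀}_y σ^{τ}_y) = 2^{#(Λ ∖ x)} (f(τ₀) + f(τ₀^x))`.
[folklore] -/
theorem sum_mul_prod_one_add_spinAt_glue (Λ : Finset V) {x : V} (hx : x ∈ Λ)
    (f : (↥Λ → ℤˣ) → ℝ) (τ₀ : ↥Λ → ℤˣ) :
    ∑ τ : ↥Λ → ℤˣ, f τ *
        ∏ y ∈ Λ.erase x, (1 + spinAt y (glue Λ τ₀ .plus) * spinAt y (glue Λ τ .plus)) =
      2 ^ (Λ.erase x).card *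
        (f τ₀ + f (Function.update τ₀ ⟨x, hx⟩ (-τ₀ ⟨x, hx⟩))) := by
  set i₀ : ↥Λ := ⟨x, hx⟩
  have hxe : x ∉ Λ.erase x := Finset.notMem_erase x Λ
  have hne : τ₀ ≠ Function.update τ₀ i₀ (-τ₀ i₀) := fun h => by
    have h1 := congrFun h i₀
    rw [Function.update_self] at h1
    exact units_ne_neg_self _ h1
  rw [Fintype.sum_eq_add τ₀ (Function.update τ₀ i₀ (-τ₀ i₀)) hne]
  · rw [glue_update, prod_one_add_spinAt_mul_update hxe, prod_one_add_spinAt_mul_self]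
    ring
  · rintro τ ⟨h0, h1⟩
    -- some site `j ≠ i₀` carries a spin different from `τ₀`
    obtain ⟨j, hj, hτj⟩ : ∃ j : ↥Λ, j ≠ i₀ ∧ τ j ≠ τ₀ j := by
      by_contra hcon
      push Not at hcon
      rcases eq_or_ne (τ i₀) (τ₀ i₀) with h | h
      · refine h0 (funext fun j => ?_)
        by_cases hji : j = i₀
        · rw [hji, h]
        · exact hcon j hji
      · refine h1 (funext fun j => ?_)
        by_cases hji : j = i₀
        · rw [hji, Function.update_self]
          rcases Int.units_eq_one_or (τ i₀) with h2 | h2 <;>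
            rcases Int.units_eq_one_or (τ₀ i₀) with h3 | h3
          · exact absurd (h2.trans h3.symm) h
          · rw [h2, h3, neg_neg]
          · rw [h2, h3]
          · exact absurd (h2.trans h3.symm) h
        · rw [Function.update_of_ne hji]
          exact hcon j hji
    have hjx : (j : V) ∈ Λ.erase x :=
      Finset.mem_erase.2 ⟨fun h => hj (Subtype.ext h), j.2⟩
    rw [Finset.prod_eq_zero hjx, mul_zero]
    rw [spinAt_glue_coe, spinAt_glue_coe, spinAt, spinAt]
    exact one_add_cast_mul_cast_eq_zero (Ne.symm hτj)

end SpinAlgebra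

/-! ### Summing the rows against the Walsh kernel -/

section Rows

variable {V : Type*} [DecidableEq V] (G : SimpleGraph V) [G.LocallyFinite]

/-- Rearrangement: for disjoint `D`, `N`,
`Σ_{B ⊆ D} π_B Σ_{S ⊆ N} π_S Σ_i ρ_i F_i σ^i_B σ^i_S = Σ_i ρ_i F_i Π_{y ∈ D ∪ N}(1 + π_y σ^i_y)`
(Walsh expansion `Σ_{A ⊆ D} π_A σ_A = Π_{y ∈ D}(1 + π_y σ_y)` on `D` and on `N`). [folklore] -/
theorem sum_powerset_sum_powerset_eq_sum_mul_prod {ι : Type*} (s : Finset ι) (ρ F : ι → ℝ)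
    (σ : ι → SpinConfig V) (π : SpinConfig V) {D N : Finset V} (hDN : Disjoint D N) :
    ∑ B ∈ D.powerset, spinProduct B π * ∑ S ∈ N.powerset, spinProduct S π *
        ∑ i ∈ s, ρ i * (F i * (spinProduct B (σ i) * spinProduct S (σ i))) =
      ∑ i ∈ s, ρ i * (F i * ∏ y ∈ D ∪ N, (1 + spinAt y π * spinAt y (σ i))) := by
  simp_rw [Finset.prod_union hDN, ← sum_powerset_spinProduct_mul_spinProduct, Finset.sum_mul_sum,
    Finset.mul_sum]
  rw [Finset.sum_comm (s := s) (t := D.powerset)]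
  refine Finset.sum_congr rfl fun B _ => ?_
  rw [Finset.sum_comm (s := s) (t := N.powerset)]
  refine Finset.sum_congr rfl fun S _ => Finset.sum_congr rfl fun i _ => ?_
  ring

/-- **Summed heat-bath rows.** If the moments of the weights `ρ_i` on configurations `σ^i` are
`E` on subsets of `Λ`, and `E` satisfies the pattern-form heat-bath rows at `x ∈ Λ`
(`N(x) ⊆ Λ`), then for every pattern `π`, with `P^i := Π_{y ∈ Λ ∖ x}(1 + π_y σ^i_y)`,
`Σ_i ρ_i σ^i_x P^i = tanh(β Σ_{y ∈ N(x)} π_y) Σ_i ρ_i P^i`: sum the row for `B` against `π_B`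
over `B ⊆ Λ ∖ ({x} ∪ N(x))` and use the Walsh expansion.
[cite: FriedliVelenik2017, Lemma 6.7] -/
theorem sum_spinAt_mul_walsh_eq_tanh_mul_of_heatBathRows {ι : Type*} [Fintype ι] (Λ : Finset V)
    (β : ℝ) (E : Finset V → ℝ) (ρ : ι → ℝ) (σ : ι → SpinConfig V)
    (hW : ∀ B : Finset V, B ⊆ Λ → ∑ i, ρ i * spinProduct B (σ i) = E B)
    {x : V} (hx : x ∈ Λ) (hN : G.neighborFinset x ⊆ Λ)
    (hrow : ∀ (π : SpinConfig V) (B : Finset V), B ⊆ Λ → x ∉ B →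
      ∑ S ∈ (G.neighborFinset x).powerset, spinProduct S π * E (insert x (symmDiff B S)) =
        Real.tanh (β * ∑ y ∈ G.neighborFinset x, spinAt y π) *
          ∑ S ∈ (G.neighborFinset x).powerset, spinProduct S π * E (symmDiff B S))
    (π : SpinConfig V) :
    ∑ i, ρ i * (spinAt x (σ i) * ∏ y ∈ Λ.erase x, (1 + spinAt y π * spinAt y (σ i))) =
      Real.tanh (β * ∑ y ∈ G.neighborFinset x, spinAt y π) *
        ∑ i, ρ i * ∏ y ∈ Λ.erase x, (1 + spinAt y π * spinAt y (σ i)) := by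
  set N := G.neighborFinset x
  have hxN : x ∉ N := fun h => ((SimpleGraph.mem_neighborFinset G x x).1 h).ne rfl
  have hNE : N ⊆ Λ.erase x := fun y hy => Finset.mem_erase.2 ⟨fun h => hxN (h ▸ hy), hN hy⟩
  set D := Λ.erase x \ N
  have hDN : Disjoint D N := Finset.sdiff_disjoint
  have hDUN : D ∪ N = Λ.erase x := Finset.sdiff_union_of_subset hNE
  -- each row, with the moments substituted
  have hrows : ∀ B ∈ D.powerset,
      spinProduct B π * ∑ S ∈ N.powerset, spinProduct S π *
          ∑ i, ρ i * (spinAt x (σ i) * (spinProduct B (σ i) * spinProduct S (σ i))) =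
        Real.tanh (β * ∑ y ∈ N, spinAt y π) * (spinProduct B π * ∑ S ∈ N.powerset,
          spinProduct S π *
            ∑ i, ρ i * (1 * (spinProduct B (σ i) * spinProduct S (σ i)))) := by
    intro B hB
    have hBD : B ⊆ D := Finset.mem_powerset.1 hB
    have hBΛ : B ⊆ Λ := hBD.trans (Finset.sdiff_subset.trans (Finset.erase_subset x Λ))
    have hxB : x ∉ B := fun h => Finset.notMem_erase x Λ (Finset.sdiff_subset (hBD h))
    have hBS : ∀ S ∈ N.powerset, x ∉ S ∧ B ∆ S ⊆ Λ := fun S hS => by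
      have hSN : S ⊆ N := Finset.mem_powerset.1 hS
      refine ⟨fun h => hxN (hSN h), fun z hz => ?_⟩
      rcases Finset.mem_symmDiff.1 hz with ⟨h, _⟩ | ⟨h, _⟩
      exacts [hBΛ h, hN (hSN h)]
    have hL : ∑ S ∈ N.powerset, spinProduct S π *
          ∑ i, ρ i * (spinAt x (σ i) * (spinProduct B (σ i) * spinProduct S (σ i))) =
        ∑ S ∈ N.powerset, spinProduct S π * E (insert x (B ∆ S)) := by
      refine Finset.sum_congr rfl fun S hS => ?_
      obtain ⟨hxS, hBSΛ⟩ := hBS S hS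
      rw [← hW _ (Finset.insert_subset hx hBSΛ)]
      congr 1
      refine Finset.sum_congr rfl fun i _ => ?_
      rw [spinProduct_insert_symmDiff hxB hxS]
    have hR : ∑ S ∈ N.powerset, spinProduct S π *
          ∑ i, ρ i * (1 * (spinProduct B (σ i) * spinProduct S (σ i))) =
        ∑ S ∈ N.powerset, spinProduct S π * E (B ∆ S) := by
      refine Finset.sum_congr rfl fun S hS => ?_
      obtain ⟨-, hBSΛ⟩ := hBS S hS
      rw [← hW _ hBSΛ]
      congr 1
      refine Finset.sum_congr rfl fun i _ => ?_
      rw [one_mul, spinProduct_mul_spinProduct]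
    rw [hL, hR, hrow π B hBΛ hxB]
    ring
  calc ∑ i, ρ i * (spinAt x (σ i) * ∏ y ∈ Λ.erase x, (1 + spinAt y π * spinAt y (σ i)))
      = ∑ B ∈ D.powerset, spinProduct B π * ∑ S ∈ N.powerset, spinProduct S π *
          ∑ i, ρ i * (spinAt x (σ i) * (spinProduct B (σ i) * spinProduct S (σ i))) := by
        rw [sum_powerset_sum_powerset_eq_sum_mul_prod _ ρ _ σ π hDN, hDUN]
    _ = ∑ B ∈ D.powerset, Real.tanh (β * ∑ y ∈ N, spinAt y π) * (spinProduct B π *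
          ∑ S ∈ N.powerset, spinProduct S π *
            ∑ i, ρ i * (1 * (spinProduct B (σ i) * spinProduct S (σ i)))) :=
        Finset.sum_congr rfl hrows
    _ = Real.tanh (β * ∑ y ∈ N, spinAt y π) *
          ∑ i, ρ i *
            ((fun _ => (1 : ℝ)) i * ∏ y ∈ Λ.erase x, (1 + spinAt y π * spinAt y (σ i))) := by
        rw [← Finset.mul_sum,
          sum_powerset_sum_powerset_eq_sum_mul_prod _ ρ (fun _ => (1 : ℝ)) σ π hDN, hDUN]
    _ = Real.tanh (β * ∑ y ∈ N, spinAt y π) *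
          ∑ i, ρ i * ∏ y ∈ Λ.erase x, (1 + spinAt y π * spinAt y (σ i)) := by
        simp only [one_mul]

/-- **Detailed balance from the heat-bath rows.** Let `ρ` be a weight on `Λ → ℤˣ` whose
`+`-glued moments are `E` (`Σ_τ ρ(τ) σ^τ_B = E(B)`, `B ⊆ Λ`), and suppose `E` satisfies the
pattern form of the one-site heat-bath rows at `x ∈ Λ` (`N(x) ⊆ Λ`):
`Σ_{S ⊆ N(x)} π_S E({x} ∪ (B ∆ S)) = tanh(β Σ_{y∈N(x)} π_y) Σ_{S ⊆ N(x)} π_S E(B ∆ S)`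
for all patterns `π` and all `B ⊆ Λ`, `x ∉ B`. Then `ρ` is in single-site detailed balance
at `x`: `ρ(τ) exp(-β σ_x Σ_{y∼x} σ_y) = ρ(τ^x) exp(β σ_x Σ_{y∼x} σ_y)` with `σ = σ^τ` and `τ^x`
the flip of `τ` at `x` — the converse direction of the one-site DLR / heat-bath identity
(Friedli–Velenik 2017, Lemma 6.7). [cite: FriedliVelenik2017, Lemma 6.7] -/
theorem balance_of_heatBathRows (Λ : Finset V) (β : ℝ) (E : Finset V → ℝ)
    (ρ : (↥Λ → ℤˣ) → ℝ)
    (hW : ∀ B : Finset V, B ⊆ Λ → ∑ τ : ↥Λ → ℤˣ, ρ τ * spinProduct B (glue Λ τ .plus) = E B)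
    {x : V} (hx : x ∈ Λ) (hN : G.neighborFinset x ⊆ Λ)
    (hrow : ∀ (π : SpinConfig V) (B : Finset V), B ⊆ Λ → x ∉ B →
      ∑ S ∈ (G.neighborFinset x).powerset, spinProduct S π * E (insert x (symmDiff B S)) =
        Real.tanh (β * ∑ y ∈ G.neighborFinset x, spinAt y π) *
          ∑ S ∈ (G.neighborFinset x).powerset, spinProduct S π * E (symmDiff B S))
    (τ₀ : ↥Λ → ℤˣ) :
    ρ τ₀ * Real.exp (-(β * spinAt x (glue Λ τ₀ .plus) *
        ∑ y ∈ G.neighborFinset x, spinAt y (glue Λ τ₀ .plus))) =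
      ρ (Function.update τ₀ ⟨x, hx⟩ (-τ₀ ⟨x, hx⟩)) * Real.exp (β * spinAt x (glue Λ τ₀ .plus) *
        ∑ y ∈ G.neighborFinset x, spinAt y (glue Λ τ₀ .plus)) := by
  -- the summed rows for the pattern `π = σ^{τ₀}`
  have h2 := sum_spinAt_mul_walsh_eq_tanh_mul_of_heatBathRows G Λ β E ρ
    (fun τ => glue Λ τ .plus) hW hx hN hrow (glue Λ τ₀ .plus)
  have hl := sum_mul_prod_one_add_spinAt_glue Λ hx
    (fun τ => ρ τ * spinAt x (glue Λ τ .plus)) τ₀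
  have hr := sum_mul_prod_one_add_spinAt_glue Λ hx ρ τ₀
  simp only [mul_assoc] at hl
  rw [hl, hr, glue_update] at h2
  have hflip : spinAt x (Function.update (glue Λ τ₀ .plus) (↑(⟨x, hx⟩ : ↥Λ)) (-τ₀ ⟨x, hx⟩)) =
      -spinAt x (glue Λ τ₀ .plus) := by
    have : -τ₀ ⟨x, hx⟩ = -(glue Λ τ₀ .plus) x := by rw [glue_apply_of_mem _ _ _ hx]
    rw [this]
    exact spinAt_update_neg_self x _
  rw [hflip] at h2
  have h2n : (2 : ℝ) ^ (Λ.erase x).card ≠ 0 := pow_ne_zero _ two_ne_zero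
  have key : spinAt x (glue Λ τ₀ .plus) *
      (ρ τ₀ - ρ (Function.update τ₀ ⟨x, hx⟩ (-τ₀ ⟨x, hx⟩))) =
      Real.tanh (β * ∑ y ∈ G.neighborFinset x, spinAt y (glue Λ τ₀ .plus)) *
        (ρ τ₀ + ρ (Function.update τ₀ ⟨x, hx⟩ (-τ₀ ⟨x, hx⟩))) := by
    apply mul_left_cancel₀ h2n
    linear_combination h2
  exact mul_exp_eq_mul_exp_of_sign_mul_tanh (spinAt_eq_one_or_eq_neg_one x _) key

end Rows

/-- **Registered sub-goal `balance_of_heatBathRows_zd3` of item stmt-CriticalPhenomena-5504**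
(the `ℤ³` instance of `balance_of_heatBathRows`, one line, fully qualified). [folklore] -/
theorem balance_of_heatBathRows_zd3 : ∀ (Λ : Finset (Literature.Probability.LatticeModels.Site 3)) (β : ℝ) (E : Finset (Literature.Probability.LatticeModels.Site 3) → ℝ) (ρ : (↥Λ → ℤˣ) → ℝ), (∀ B : Finset (Literature.Probability.LatticeModels.Site 3), B ⊆ Λ → ∑ τ : ↥Λ → ℤˣ, ρ τ * Literature.Probability.LatticeModels.spinProduct B (Literature.Probability.LatticeModels.glue Λ τ Literature.Probability.LatticeModels.BoundaryCondition.plus) = E B) → ∀ (x : Literature.Probability.LatticeModels.Site 3) (hx : x ∈ Λ), (Literature.Probability.LatticeModels.zdGraph 3).neighborFinset x ⊆ Λ → (∀ (π : Literature.Probability.LatticeModels.SpinConfig (Literature.Probability.LatticeModels.Site 3)) (B : Finset (Literature.Probability.LatticeModels.Site 3)), B ⊆ Λ → x ∉ B → ∑ S ∈ ((Literature.Probability.LatticeModels.zdGraph 3).neighborFinset x).powerset, Literature.Probability.LatticeModels.spinProduct S π * E (insert x (symmDiff B S)) = Real.tanh (β * ∑ y ∈ (Literature.Probability.LatticeModels.zdGraph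 3).neighborFinset x, Literature.Probability.LatticeModels.spinAt y π) * ∑ S ∈ ((Literature.Probability.LatticeModels.zdGraph 3).neighborFinset x).powerset, Literature.Probability.LatticeModels.spinProduct S π * E (symmDiff B S)) → ∀ τ₀ : ↥Λ → ℤˣ, ρ τ₀ * Real.exp (-(β * Literature.Probability.LatticeModels.spinAt x (Literature.Probability.LatticeModels.glue Λ τ₀ Literature.Probability.LatticeModels.BoundaryCondition.plus) * ∑ y ∈ (Literature.Probability.LatticeModels.zdGraph 3).neighborFinset x, Literature.Probability.LatticeModels.spinAt y (Literature.Probability.LatticeModels.glue Λ τ₀ Literature.Probability.LatticeModels.BoundaryCondition.plus))) = ρ (Function.update τ₀ ⟨x, hx⟩ (-τ₀ ⟨x, hx⟩)) * Real.exp (β * Literature.Probability.LatticeModels.spinAt x (Literature.Probability.LatticeModels.glue Λ τ₀ Literature.Probability.LatticeModels.BoundaryCondition.plus) * ∑ y ∈ (Literature.Probability.LatticeModels.zdGraph 3).neighborFinset x, Literature.Probability.LatticeModels.spinAt y (Literature.Probability.LatticeModels.glue Λ τ₀ Literature.Probability.LatticeModels.BoundaryCondition.plus)) :=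
  fun Λ β E ρ hW _ hx hN hrow τ₀ =>
    balance_of_heatBathRows (Literature.Probability.LatticeModels.zdGraph 3) Λ β E ρ hW hx hN hrow τ₀

end Summit.CriticalPhenomena.Ising3DConformalLimit.Theorems


end
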